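import Mathlib
import Summits.NavierStokesRegularity.NavierStokesRegularity.Theorems.EulerZoomLiouvillePowerGaugeEulerLiouvilleCollapseEnergy
import Summits.NavierStokesRegularity.NavierStokesRegularity.Theses.EulerZoomLiouville
import HarnessLib

/-!
# ENERGY SATURATION for classical discretely self-similar members of the crux
# `EulerZoomLiouville.PowerGaugeEulerLiouville` in the window (route №10, item stmt-NavierStokesRegularity-19832)

Helper file (theorems only; `--supports stmt-NavierStokesRegularity-19832`). Seat ns-typeII-p3 (cell
ns-regularity-ideate §B, D-0081).  Rung C2 (discretely self-similar members) of
`Cruxes/PowerGaugeEulerLiouville/Lines/rungC_window.lean`, inside the lead's open stub `stub_nonSelfSimilar ⊇ DSS`.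

THE STRATUM.  Let `(u, p)` be a CLASSICAL Euler flow on the open slab `(−∞,0) × ℝ³`, discretely self-similar
for the class scaling with exponent `0 < ρ ≤ 1/2` and factor `l > 1` (`u(τ,y) = l^{1+ρ} u(l^{2+ρ}τ, l y)`), with
the far-field shell bound `∫_{R≤|y|≤2R}(|u(τ)|³ + 2|p(τ)||u(τ)|) ≤ K R^β` for `R ≥ R₀(−τ)^γ`, some `β < 1`
(the natural scale-invariant tails give `β = −3ρ`, `γ = 1/(2+ρ)`: `shell_le_of_pointwise_tail` in the
companion file `…CollapseEnergyTail`).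

* `eq_zero_of_dss_subExtremal` — **SUB-EXTREMAL ⇒ TRIVIAL**: if at ONE time `τ₀ < 0` the normalised ball
  energy `R^{2ρ−1}∫_{B_R}|u(τ₀)|²` takes values `≤ ε` at arbitrarily large `R` for every `ε > 0`
  (`liminf_{R→∞} R^{2ρ−1}∫_{B_R}|u(τ₀)|² = 0`), then `u ≡ 0` on the slab;
* `dss_energy_saturation` — contrapositive: **a nontrivial classical DSS member SATURATES the `A`-gauge at every
  time**: for every `τ₀ < 0` there are `c₁ > 0`, `R₁` with `∫_{B_R}|u(τ₀)|² ≥ c₁ R^{1−2ρ}` for all `R ≥ R₁`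
  — the two-sided energy law of Bronzi–Shvydkoy 2015 Thm 1.1 (arXiv:1310.8611; exactly self-similar, `C³`
  profiles) for λ-DSS collapse, classical members, physical variables;
* `powerGaugeEulerLiouville_dss_subExtremal` — the crux VERBATIM plus «classical, DSS, shell bound, sub-extremal
  at one time» ⇒ `u = 0` a.e. (binder form; a literal sub-case of the crux, cf. the lineage's
  `VorticityDecay.dss_vorticityDecay_of_powerGaugeEulerLiouville`).

MECHANISM (`…CollapseEnergy`): DSS covariance of the cut-off energies `e_R(τ) = l^{2ρ−1} e_{lR}(l^{2+ρ}τ)`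
(`cutoffEnergy_dss`, `cutoffEnergy_dss_iterate`) transports smallness of `∫_{B_R}|u(τ₀)|²` at large `R` DOWN
the scaling orbit to smallness of `e_{l^k}(τ)` at times `τ → 0⁻`, for every `k`; the collapse-time triviality
criterion `eq_zero_of_collapseEnergy_vanishing` (energy identity + flux freeze) concludes.  The exactly
self-similar case is in the tree in the WEAK class and stronger there (stub `selfSimilarSubExtremal`, worker
ns-ezl-19832-w2, `EnergySaturation.selfSimilar_ae_eq_zero_of_subExtremal`, via the profile local energy
EQUALITY — a lever with no DSS analogue for `H¹` time-dependent profiles); the DSS case is the new content, and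
it uses the Euler IDENTITY of classical members (Chae–Wolf 2020 Cor. 1.5 is the energy-conserving scale
`ρ = 1/2` with FINITE energy; the lineage's `…DSSFiniteEnergy` is the finite-energy window case).

WHAT THIS IS NOT: not NS, not the crux E, not rung C2 — the EXTREMAL classical DSS profiles
(`∫_{B_R}|u|² ≍ R^{1−2ρ}`, natural tails) and all non-classical members are untouched.  [folklore; cf.
BronziShvydkoy2015 Thm 1.1]
-/

noncomputable section

-- the summit and its single problem share the name `NavierStokesRegularity` (D-0017 nested layout)
set_option linter.dupNamespace false

open Set Function Filter Topology MeasureTheory Metric Module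
open scoped NNReal ENNReal InnerProductSpace RealInnerProductSpace

namespace Summit.NavierStokesRegularity.NavierStokesRegularity.Theorems.PowerGaugeEulerLiouville.CollapseEnergy

open Literature.Analysis Literature.Analysis.FluidPDE

variable {u : ℝ → EuclideanSpace ℝ (Fin 3) → EuclideanSpace ℝ (Fin 3)} {p : ℝ → EuclideanSpace ℝ (Fin 3) → ℝ}

/-! ## DSS covariance of the cut-off energies -/

/-- The cut-offs are dilation-covariant: `χ_{lR}(l y) = χ_R(y)`. [folklore] -/
theorem cutoff_mul_smul {l R : ℝ} (hl : l ≠ 0) (y : EuclideanSpace ℝ (Fin 3)) :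
    cutoff (l * R) (l • y) = cutoff R y := by
  rw [cutoff_apply, cutoff_apply, smul_smul, show (l * R)⁻¹ * l = R⁻¹ by field_simp]

/-- **DSS covariance of the cut-off energies.** If `u(τ, y) = l^{1+ρ} u(l^{2+ρ}τ, l y)` (`l > 0`, `τ < 0`), then
`∫ χ_R |u(τ)|² = l^{2ρ−1} ∫ χ_{lR} |u(l^{2+ρ}τ)|²`. [folklore] -/
theorem cutoffEnergy_dss {ρ l : ℝ} (hl : 0 < l)
    (hdss : ∀ τ : ℝ, τ < 0 → ∀ y, u τ y = (l ^ (1 + ρ)) • u ((l ^ (2 + ρ)) * τ) (l • y))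
    {τ : ℝ} (hτ : τ < 0) (R : ℝ) :
    ∫ y, cutoff R y * ‖u τ y‖ ^ 2 =
      l ^ (2 * ρ - 1) * ∫ x, cutoff (l * R) x * ‖u ((l ^ (2 + ρ)) * τ) x‖ ^ 2 := by
  have hl0 : l ≠ 0 := hl.ne'
  have h1 : ∀ y, cutoff R y * ‖u τ y‖ ^ 2 =
      l ^ (2 + 2 * ρ) * (cutoff (l * R) (l • y) * ‖u ((l ^ (2 + ρ)) * τ) (l • y)‖ ^ 2) := by
    intro y
    rw [hdss τ hτ y, norm_smul, Real.norm_of_nonneg (Real.rpow_nonneg hl.le _), mul_pow,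
      cutoff_mul_smul hl0, ← Real.rpow_natCast, ← Real.rpow_mul hl.le]
    push_cast
    ring_nf
  simp_rw [h1]
  rw [integral_const_mul]
  have hcv := Measure.integral_comp_smul volume
    (fun x : EuclideanSpace ℝ (Fin 3) => cutoff (l * R) x * ‖u ((l ^ (2 + ρ)) * τ) x‖ ^ 2) l
  rw [hcv, finrank_euclideanSpace, Fintype.card_fin, smul_eq_mul, abs_of_pos (by positivity),
    ← mul_assoc]
  congr 1
  have h3 : (l ^ 3)⁻¹ = l ^ (-(3 : ℝ)) := by
    rw [Real.rpow_neg hl.le, show (3 : ℝ) = ((3 : ℕ) : ℝ) by norm_num, Real.rpow_natCast]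
  rw [h3, ← Real.rpow_add hl]
  ring_nf

/-- Iterated DSS covariance: `∫ χ_R |u(τ)|² = (l^{2ρ−1})^m ∫ χ_{l^m R} |u((l^{2+ρ})^m τ)|²`. [folklore] -/
theorem cutoffEnergy_dss_iterate {ρ l : ℝ} (hl : 0 < l)
    (hdss : ∀ τ : ℝ, τ < 0 → ∀ y, u τ y = (l ^ (1 + ρ)) • u ((l ^ (2 + ρ)) * τ) (l • y)) (m : ℕ) :
    ∀ {τ : ℝ}, τ < 0 → ∀ R : ℝ, ∫ y, cutoff R y * ‖u τ y‖ ^ 2 =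
      (l ^ (2 * ρ - 1)) ^ m * ∫ x, cutoff (l ^ m * R) x * ‖u ((l ^ (2 + ρ)) ^ m * τ) x‖ ^ 2 := by
  induction m with
  | zero => intro τ _ R; simp
  | succ m ih =>
    intro τ hτ R
    have hτ' : (l ^ (2 + ρ)) ^ m * τ < 0 := mul_neg_of_pos_of_neg (by positivity) hτ
    rw [ih hτ R, cutoffEnergy_dss hl hdss hτ' (l ^ m * R), pow_succ, pow_succ]
    ring_nf

/-! ## Comparison of cut-off and ball energies -/

/-- `∫ χ_{R/2}|u(τ)|² ≤ ∫_{B_R}|u(τ)|²` (`χ_{R/2}` vanishes off `B_R` and is at most `1`). [folklore] -/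
theorem cutoffEnergy_half_le_setIntegral_ball {τ R : ℝ} (hR : 0 < R) (hu : Continuous (u τ)) :
    ∫ x, cutoff (R / 2) x * ‖u τ x‖ ^ 2 ≤ ∫ x in ball (0 : EuclideanSpace ℝ (Fin 3)) R, ‖u τ x‖ ^ 2 := by
  have hg : Continuous fun x => ‖u τ x‖ ^ 2 := (hu.norm).pow 2
  rw [← integral_indicator measurableSet_ball]
  refine integral_mono ?_ ?_ fun x => ?_
  · refine ((contDiff_cutoff (n := 0) (R / 2)).continuous.mul hg).integrable_of_hasCompactSupport ?_
    exact (hasCompactSupport_cutoff (by positivity)).mul_right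
  · exact ((hg.continuousOn.integrableOn_compact (isCompact_closedBall (0 : EuclideanSpace ℝ (Fin 3)) R)).mono_set
      ball_subset_closedBall).integrable_indicator measurableSet_ball
  · by_cases hx : x ∈ ball (0 : EuclideanSpace ℝ (Fin 3)) R
    · rw [indicator_of_mem hx]
      exact mul_le_of_le_one_left (sq_nonneg _) (cutoff_le_one _ _)
    · rw [indicator_of_notMem hx]
      have hxR : 2 * (R / 2) ≤ ‖x‖ := by
        rw [mem_ball_zero_iff, not_lt] at hx
        linarith
      rw [cutoff_eq_zero (by positivity) hxR, zero_mul]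

/-- Quasi-monotonicity in the radius: `∫ χ_{R₁}|u(τ)|² ≤ ∫ χ_{R₂}|u(τ)|²` whenever `2R₁ ≤ R₂` (through the
ball `B_{2R₁}`). [folklore] -/
theorem cutoffEnergy_le_of_two_mul_le {τ R₁ R₂ : ℝ} (hR₁ : 0 < R₁) (h : 2 * R₁ ≤ R₂) (hu : Continuous (u τ)) :
    ∫ x, cutoff R₁ x * ‖u τ x‖ ^ 2 ≤ ∫ x, cutoff R₂ x * ‖u τ x‖ ^ 2 := by
  have h1 := cutoffEnergy_half_le_setIntegral_ball (u := u) (τ := τ) (R := 2 * R₁) (by positivity) hu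
  rw [show 2 * R₁ / 2 = R₁ by ring] at h1
  exact h1.trans (setIntegral_ball_le_cutoffEnergy (by linarith) h hu)

/-! ## The stratum: sub-extremal classical DSS members are trivial -/

/-- Real-power bookkeeping: `(l^{2ρ−1})^m · (l^m X)^{1−2ρ} = X^{1−2ρ}` for `l, X > 0`. [folklore] -/
theorem rpow_dss_cancel {l X ρ : ℝ} (hl : 0 < l) (hX : 0 < X) (m : ℕ) :
    (l ^ (2 * ρ - 1)) ^ m * (l ^ m * X) ^ (1 - 2 * ρ) = X ^ (1 - 2 * ρ) := by
  rw [Real.mul_rpow (by positivity) hX.le, ← Real.rpow_natCast (l ^ (2 * ρ - 1)) m,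
    ← Real.rpow_mul hl.le, ← Real.rpow_natCast l m, ← Real.rpow_mul hl.le, ← mul_assoc,
    ← Real.rpow_add hl]
  have : (2 * ρ - 1) * (m : ℝ) + (m : ℝ) * (1 - 2 * ρ) = 0 := by ring
  rw [this, Real.rpow_zero, one_mul]

/-- **SUB-EXTREMAL CLASSICAL DSS MEMBERS ARE TRIVIAL** (`0 < ρ ≤ 1/2`).  Let `(u, p)` be a classical Euler flow
on the open slab, DSS with exponent `ρ` and factor `l > 1`, with the shell bound
`∫_{R≤|y|≤2R}(|u(τ)|³ + 2|p(τ)||u(τ)|) ≤ K R^β` for `R ≥ R₀(−τ)^γ` (`β < 1`).  If at one time `τ₀ < 0`, for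
every `ε > 0`, `R^{2ρ−1}∫_{B_R}|u(τ₀)|² ≤ ε` at arbitrarily large `R`, then `u ≡ 0` on the slab.  Proof: for a
target radius `l^k`, pick `R` large and sub-extremal, scale DOWN `m` times along the DSS orbit so that
`R/(2l^m) ∈ [2l^k, 2l^{k+1})`; the cut-off energy at radius `l^k` and time `τ₀/l^{m(2+ρ)} ∈ [τ₁, 0)` is then
`≤ ε'(4l^{k+1})^{1−2ρ}`; conclude by `eq_zero_of_collapseEnergy_vanishing`.  [folklore; cf. BronziShvydkoy2015
Thm 1.1 (self-similar case)] -/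
theorem eq_zero_of_dss_subExtremal (hns : IsClassicalNSSolutionOn (Iio 0) 0 0 u p) {ρ : ℝ} (hρ : 0 < ρ)
    (hρh : ρ ≤ 1 / 2) {l : ℝ} (hl : 1 < l)
    (hdss : ∀ τ : ℝ, τ < 0 → ∀ y, u τ y = (l ^ (1 + ρ)) • u ((l ^ (2 + ρ)) * τ) (l • y))
    {K R₀ γ β : ℝ} (hK : 0 ≤ K) (hR₀ : 0 ≤ R₀) (hγ : 0 ≤ γ) (hβ : β < 1)
    (hshell : ∀ τ : ℝ, τ < 0 → ∀ R : ℝ, 0 < R → R₀ * (-τ) ^ γ ≤ R →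
      ∫ x in {y : EuclideanSpace ℝ (Fin 3) | R ≤ ‖y‖ ∧ ‖y‖ ≤ 2 * R},
        (‖u τ x‖ ^ 3 + 2 * |p τ x| * ‖u τ x‖) ≤ K * R ^ β)
    {τ₀ : ℝ} (hτ₀ : τ₀ < 0)
    (hsub : ∀ ε : ℝ, 0 < ε → ∀ Rbar : ℝ, ∃ R : ℝ, Rbar ≤ R ∧
      R ^ (2 * ρ - 1) * ∫ x in ball (0 : EuclideanSpace ℝ (Fin 3)) R, ‖u τ₀ x‖ ^ 2 ≤ ε) :
    ∀ τ : ℝ, τ < 0 → ∀ y : EuclideanSpace ℝ (Fin 3), u τ y = 0 := by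
  have hl0 : 0 < l := lt_trans one_pos hl
  have hL : 1 < l ^ (2 + ρ) := Real.one_lt_rpow hl (by linarith)
  have hL0 : 0 < l ^ (2 + ρ) := lt_trans one_pos hL
  have h12ρ : 0 ≤ 1 - 2 * ρ := by linarith
  refine eq_zero_of_collapseEnergy_vanishing hns hK hR₀ hγ hβ hshell fun Rbar => ?_
  -- target radius `l^k ≥ Rbar`
  obtain ⟨k, hk⟩ := pow_unbounded_of_one_lt Rbar hl
  refine ⟨l ^ k, hk.le, fun ε hε τ₁ hτ₁ => ?_⟩
  have hlk : 0 < l ^ k := pow_pos hl0 k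
  -- `m₀` with `(l^{2+ρ})^{m₀} ≥ τ₀/τ₁`, so that `τ₀/(l^{2+ρ})^m ≥ τ₁` for `m ≥ m₀`
  obtain ⟨m₀, hm₀⟩ := pow_unbounded_of_one_lt (τ₀ / τ₁) hL
  -- the sub-extremal radius
  set ε' : ℝ := ε / (4 * l ^ (k + 1)) ^ (1 - 2 * ρ) with hε'
  have hD : 0 < (4 * l ^ (k + 1)) ^ (1 - 2 * ρ) := Real.rpow_pos_of_pos (by positivity) _
  have hε'0 : 0 < ε' := div_pos hε hD
  obtain ⟨R, hRge, hRsub⟩ := hsub ε' hε'0 (4 * l ^ (k + m₀ + 1))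
  have hA : 0 < 2 * l ^ k := by positivity
  have hRpos : 0 < R := lt_of_lt_of_le (by positivity) hRge
  -- choose `m` with `2 l^k ≤ (R/2)/l^m < 2 l^{k+1}`
  set X : ℝ := R / 2 with hX
  have hX0 : 0 < X := by positivity
  have hXA : 1 ≤ X / (2 * l ^ k) := by
    rw [le_div_iff₀ hA, hX]
    have : l ^ (k + m₀ + 1) ≥ l ^ k := pow_le_pow_right₀ hl.le (by omega)
    linarith
  obtain ⟨m, hm1, hm2⟩ := exists_nat_pow_near hXA hl
  have hlm : 0 < l ^ m := pow_pos hl0 m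
  set R₂ : ℝ := X / l ^ m with hR₂
  have hR₂lo : 2 * l ^ k ≤ R₂ := by
    rw [hR₂, le_div_iff₀ hlm]
    have := (le_div_iff₀ hA).1 hm1
    linarith
  have hR₂hi : R₂ < 2 * l ^ (k + 1) := by
    rw [hR₂, div_lt_iff₀ hlm]
    have := (div_lt_iff₀ hA).1 hm2
    rw [pow_succ] at this ⊢
    linarith
  have hR₂pos : 0 < R₂ := lt_of_lt_of_le hA hR₂lo
  -- `m ≥ m₀ + 1`, hence the transported time lies in `[τ₁, 0)`
  have hmm₀ : m₀ < m := by
    have h1 : X < l ^ (m + 1) * (2 * l ^ k) := (div_lt_iff₀ hA).1 hm2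
    have h2 : l ^ (m₀ + 1) * (2 * l ^ k) ≤ X := by
      rw [hX]
      have : 4 * l ^ (k + m₀ + 1) = 2 * (l ^ (m₀ + 1) * (2 * l ^ k)) := by ring
      linarith
    have h3 : l ^ (m₀ + 1) < l ^ (m + 1) := by
      by_contra hcon
      push Not at hcon
      have := mul_le_mul_of_nonneg_right hcon hA.le
      linarith
    have := (pow_lt_pow_iff_right₀ hl).1 h3
    omega
  set τ : ℝ := τ₀ / (l ^ (2 + ρ)) ^ m with hτdef
  have hLm : 0 < (l ^ (2 + ρ)) ^ m := pow_pos hL0 m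
  have hτneg : τ < 0 := div_neg_of_neg_of_pos hτ₀ hLm
  have hτ₁τ : τ₁ ≤ τ := by
    rw [hτdef, le_div_iff₀ hLm]
    have h1 : τ₀ / τ₁ < (l ^ (2 + ρ)) ^ m :=
      hm₀.trans (pow_lt_pow_right₀ hL hmm₀)
    have h2 := (div_lt_iff_of_neg hτ₁).1 h1
    linarith
  refine ⟨τ, hτ₁τ, hτneg, ?_⟩
  -- transport: `e_{R₂}(τ) = (l^{2ρ-1})^m e_{X}(τ₀)`
  have htrans := cutoffEnergy_dss_iterate hl0 hdss m hτneg R₂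
  have hmR : l ^ m * R₂ = X := by rw [hR₂]; field_simp
  have hmτ : (l ^ (2 + ρ)) ^ m * τ = τ₀ := by rw [hτdef]; field_simp
  rw [hmR, hmτ] at htrans
  -- smallness at `(X, τ₀)`: `e_X(τ₀) ≤ ∫_{B_R}|u(τ₀)|² ≤ ε' R^{1-2ρ}`
  have hu₀ : Continuous (u τ₀) := (hns.contDiff_velocity hτ₀).continuous
  have huτ : Continuous (u τ) := (hns.contDiff_velocity hτneg).continuous
  have hsmall : ∫ x, cutoff X x * ‖u τ₀ x‖ ^ 2 ≤ ε' * R ^ (1 - 2 * ρ) := by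
    have h1 := cutoffEnergy_half_le_setIntegral_ball (u := u) (τ := τ₀) hRpos hu₀
    have hRpow : 0 < R ^ (2 * ρ - 1) := Real.rpow_pos_of_pos hRpos _
    have h2 : ∫ x in ball (0 : EuclideanSpace ℝ (Fin 3)) R, ‖u τ₀ x‖ ^ 2 ≤ ε' * R ^ (1 - 2 * ρ) := by
      have h3 := (le_div_iff₀' hRpow).2 hRsub
      have h4 : ε' / R ^ (2 * ρ - 1) = ε' * R ^ (1 - 2 * ρ) := by
        rw [div_eq_mul_inv, ← Real.rpow_neg hRpos.le, neg_sub]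
      rwa [h4] at h3
    exact h1.trans h2
  -- conclusion at radius `l^k`
  calc ∫ x, cutoff (l ^ k) x * ‖u τ x‖ ^ 2
      ≤ ∫ x, cutoff R₂ x * ‖u τ x‖ ^ 2 := cutoffEnergy_le_of_two_mul_le hlk hR₂lo huτ
    _ = (l ^ (2 * ρ - 1)) ^ m * ∫ x, cutoff X x * ‖u τ₀ x‖ ^ 2 := htrans
    _ ≤ (l ^ (2 * ρ - 1)) ^ m * (ε' * R ^ (1 - 2 * ρ)) :=
        mul_le_mul_of_nonneg_left hsmall (pow_nonneg (Real.rpow_nonneg hl0.le _) m)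
    _ = ε' * (2 * R₂) ^ (1 - 2 * ρ) := by
        have hRX : R = l ^ m * (2 * R₂) := by
          rw [hR₂, hX]; field_simp
        rw [hRX, mul_left_comm, rpow_dss_cancel hl0 (by positivity) m]
    _ ≤ ε' * (4 * l ^ (k + 1)) ^ (1 - 2 * ρ) := by
        refine mul_le_mul_of_nonneg_left (Real.rpow_le_rpow (by positivity) (by linarith) h12ρ) hε'0.le
    _ = ε := by rw [hε', div_mul_cancel₀ _ hD.ne']

/-- **ENERGY SATURATION of nontrivial classical DSS members** (`0 < ρ ≤ 1/2`; contrapositive of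
`eq_zero_of_dss_subExtremal`): if `u` does not vanish identically, then at every time `τ₀ < 0` there are
`c₁ > 0` and `R₁` with `c₁ R^{1−2ρ} ≤ ∫_{B_R}|u(τ₀)|²` for all `R ≥ R₁` — together with the `A`-gauge
(`≤ c R^{1−2ρ}`) the two-sided law `∫_{B_R}|u(τ₀)|² ≍ R^{1−2ρ}` of Bronzi–Shvydkoy 2015 Thm 1.1, for λ-DSS.
[folklore; cf. BronziShvydkoy2015 Thm 1.1] -/
theorem dss_energy_saturation (hns : IsClassicalNSSolutionOn (Iio 0) 0 0 u p) {ρ : ℝ} (hρ : 0 < ρ)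
    (hρh : ρ ≤ 1 / 2) {l : ℝ} (hl : 1 < l)
    (hdss : ∀ τ : ℝ, τ < 0 → ∀ y, u τ y = (l ^ (1 + ρ)) • u ((l ^ (2 + ρ)) * τ) (l • y))
    {K R₀ γ β : ℝ} (hK : 0 ≤ K) (hR₀ : 0 ≤ R₀) (hγ : 0 ≤ γ) (hβ : β < 1)
    (hshell : ∀ τ : ℝ, τ < 0 → ∀ R : ℝ, 0 < R → R₀ * (-τ) ^ γ ≤ R →
      ∫ x in {y : EuclideanSpace ℝ (Fin 3) | R ≤ ‖y‖ ∧ ‖y‖ ≤ 2 * R},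
        (‖u τ x‖ ^ 3 + 2 * |p τ x| * ‖u τ x‖) ≤ K * R ^ β)
    (hne : ∃ τ : ℝ, τ < 0 ∧ ∃ y, u τ y ≠ 0) {τ₀ : ℝ} (hτ₀ : τ₀ < 0) :
    ∃ c₁ : ℝ, 0 < c₁ ∧ ∃ R₁ : ℝ, ∀ R : ℝ, R₁ ≤ R →
      c₁ * R ^ (1 - 2 * ρ) ≤ ∫ x in ball (0 : EuclideanSpace ℝ (Fin 3)) R, ‖u τ₀ x‖ ^ 2 := by
  by_contra hcon
  push Not at hcon
  obtain ⟨τ, hτ, y, hy⟩ := hne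
  refine hy (eq_zero_of_dss_subExtremal hns hρ hρh hl hdss hK hR₀ hγ hβ hshell hτ₀ ?_ τ hτ y)
  intro ε hε Rbar
  obtain ⟨R, hR, hlt⟩ := hcon ε hε (max Rbar 1)
  have hRpos : 0 < R := lt_of_lt_of_le one_pos ((le_max_right _ _).trans hR)
  refine ⟨R, (le_max_left _ _).trans hR, ?_⟩
  have hRpow : 0 < R ^ (1 - 2 * ρ) := Real.rpow_pos_of_pos hRpos _
  have h1 : (∫ x in ball (0 : EuclideanSpace ℝ (Fin 3)) R, ‖u τ₀ x‖ ^ 2) / R ^ (1 - 2 * ρ) < ε :=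
    (div_lt_iff₀ hRpow).2 hlt
  rw [show R ^ (2 * ρ - 1) = (R ^ (1 - 2 * ρ))⁻¹ by
    rw [← Real.rpow_neg hRpos.le, neg_sub], inv_mul_eq_div]
  exact h1.le

/-! ## The stratum in the crux's binder shape -/

/-- **The stratum in the binder shape of the crux**: `PowerGaugeEulerLiouville` VERBATIM (its three hypotheses,
unused) plus «`ρ ≤ 1/2`, classical on the open slab, DSS with factor `l > 1`, the shell bound with some `β < 1`,
and sub-extremal ball energy at one time» ⇒ `u = 0` a.e. on the slab. [folklore] -/
theorem powerGaugeEulerLiouville_dss_subExtremal :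
    ∀ ρ : ℝ, 0 < ρ → ∀ (u : ℝ → EuclideanSpace ℝ (Fin 3) → EuclideanSpace ℝ (Fin 3))
      (p : ℝ → EuclideanSpace ℝ (Fin 3) → ℝ)
      (H : ℝ → EuclideanSpace ℝ (Fin 3) → EuclideanSpace ℝ (Fin 3) →L[ℝ] EuclideanSpace ℝ (Fin 3)) (c : ℝ≥0)
      (l K R₀ γ β τ₀ : ℝ),
      IsSuitableWeakSolutionOn (slab (EuclideanSpace ℝ (Fin 3)) (Iio 0) isOpen_Iio) 0 0 u p →
      HasWeakSpatialGradientOn (slab (EuclideanSpace ℝ (Fin 3)) (Iio 0) isOpen_Iio) u H →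
      (∀ a : ℝ, 0 < a → ENNReal.ofReal (a ^ (2 * ρ)) * cknA a (0 : ℝ × EuclideanSpace ℝ (Fin 3)) u +
        ENNReal.ofReal (a ^ ρ) * cknE a (0 : ℝ × EuclideanSpace ℝ (Fin 3)) H +
        ENNReal.ofReal (a ^ (2 * ρ)) * cknD a (0 : ℝ × EuclideanSpace ℝ (Fin 3)) p ≤ (c : ℝ≥0∞)) →
      ρ ≤ 1 / 2 →
      IsClassicalNSSolutionOn (Iio 0) 0 0 u p →
      1 < l →
      (∀ τ : ℝ, τ < 0 → ∀ y, u τ y = (l ^ (1 + ρ)) • u ((l ^ (2 + ρ)) * τ) (l • y)) →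
      0 ≤ K → 0 ≤ R₀ → 0 ≤ γ → β < 1 →
      (∀ τ : ℝ, τ < 0 → ∀ R : ℝ, 0 < R → R₀ * (-τ) ^ γ ≤ R →
        ∫ x in {y : EuclideanSpace ℝ (Fin 3) | R ≤ ‖y‖ ∧ ‖y‖ ≤ 2 * R},
          (‖u τ x‖ ^ 3 + 2 * |p τ x| * ‖u τ x‖) ≤ K * R ^ β) →
      τ₀ < 0 →
      (∀ ε : ℝ, 0 < ε → ∀ Rbar : ℝ, ∃ R : ℝ, Rbar ≤ R ∧
        R ^ (2 * ρ - 1) * ∫ x in ball (0 : EuclideanSpace ℝ (Fin 3)) R, ‖u τ₀ x‖ ^ 2 ≤ ε) →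
      Function.uncurry u =ᵐ[volume.restrict (Iio (0 : ℝ) ×ˢ (univ : Set (EuclideanSpace ℝ (Fin 3))))] 0 := by
  intro ρ hρ u p H c l K R₀ γ β τ₀ _ _ _ hρh hns hl hdss hK hR₀ hγ hβ hshell hτ₀ hsub
  have h := eq_zero_of_dss_subExtremal hns hρ hρh hl hdss hK hR₀ hγ hβ hshell hτ₀ hsub
  refine (ae_restrict_iff' (measurableSet_Iio.prod MeasurableSet.univ)).2 (Eventually.of_forall ?_)
  rintro ⟨τ, y⟩ ⟨hτ, -⟩
  exact h τ hτ y

end Summit.NavierStokesRegularity.NavierStokesRegularity.Theorems.PowerGaugeEulerLiouville.CollapseEnergy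

end
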